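import Summits.Ventures.QEC.Census.CertCoverSyndrome
import HarnessLib

/-!
# Cover reduction, part 3: the coset-enumeration checker and its soundness (L-coset)
# (qec lane ε, director-qec R29; census/search-9/cover/README.md §3–§4, §7 R3)

* `CosetProb` / `cosetOK nq Hq D P` — ONE affine low-weight enumeration problem «every `y` with `Hq y = σ`,
  `|y ∖ U| ≤ f` …» and its Bool checker: a particular solution `y0` (zero on the information positions `T ⊆ Ū`),
  kernel rows `G` systematic on `T`, kernel rows `BU` supported inside `U`, COMPLETENESS coefficients expressing every
  generator of `ker Hq` (the list `D`, e.g. `H^Z` pivot rows ++ logicals, which spans `ker Hq` by L1) over `G` and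
  `BU`, and the ENUMERATION VERDICT = the tree's `scan` with leaf `bzLeaf f allow` over the rows of `G` with `U`-bits
  cleared, STARTED AT the offset (`2^|G|`, `y0` with `U`-bits cleared) — no new enumeration engine;
* ★ `coset_sound` (L-coset): `cosetOK` + «`D` spans `ker Hq`» ⇒ every solution `y < 2^nq` of `Hq y = σ` with
  `|y ∖ U| ≤ f` has its outside part `clr U y` ALLOW-LISTED and is `y0 ⊕ xorSel G (selOf T y) ⊕ xorSel BU m` — so any
  LINEAR functional of `y` that vanishes on `BU` is read off the allow-list entry (`functional_of_coset`);
* bit lemmas for `clr` (`x AND NOT U`), `selOf`, `xorSel`; `exists_xorSel_of_mem_rowSpace`; a toy control by `decide`.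

HONEST FRAMING: generic; no code, no distance; everything proved; `decide`-evaluable checks. No instances, no notation.
-/

namespace Summit.Ventures.QEC.Census

open Matrix Literature.InformationTheory.QuantumCodes

/-! ## The coset-enumeration problem and its checker -/

/-- Clearing the bits of `U`: `clr U x = x AND NOT U` (= `x ⊕ (x ∧ U)`). (definition) -/
def clr (U x : ℕ) : ℕ := x ^^^ (x &&& U)

/-- The selection read off a word on the information positions: bit `j` of `selOf T y` = bit `T[j]` of `y`.
(definition) -/
def selOf (T : List ℕ) (y : ℕ) : ℕ := mkBits T.length fun j => y.testBit (T.getD j 0)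

/-- ONE coset-enumeration problem «every `y` with `Hq y = σ` and `|y ∖ U| ≤ f` …» and its certificate data
(README §3 LEVEL 2→1 / 1→0; JSON `problems[]`): the fixed support `U` (as a mask), the depth `f`, the target syndrome
`sigma`, a particular solution `y0` vanishing on `T`, the information positions `T ⊆ Ū`, kernel rows `G` (full
length, systematic on `T`), kernel rows `BU` supported inside `U`, completeness coefficients `coef` (one selection
word over `G ++ BU` per generator of the kernel list `D`), and the allow-list of outside parts. -/
structure CosetProb where
  /-- the fixed support `U = supp u`, as a bitmask -/
  U : ℕ
  /-- enumeration depth `f = (W − |u|) / 2` -/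
  f : ℕ
  /-- target syndrome word `σ(u)` (bit `r̄` per row of `Hq`) -/
  sigma : ℕ
  /-- a particular solution of `Hq y = σ`, zero on the positions `T` -/
  y0 : ℕ
  /-- information positions (outside `U`), ordered as the rows of `G` -/
  T : List ℕ
  /-- kernel rows, systematic on `T` -/
  G : List ℕ
  /-- kernel rows supported inside `U` -/
  BU : List ℕ
  /-- completeness, `G`-part: selection words over `G`, one per entry of the kernel generator list `D` -/
  coefG : List ℕ
  /-- completeness, `BU`-part: selection words over `BU`, one per entry of `D` (`D[i] = xorSel G coefG[i] ⊕
  xorSel BU coefB[i]`) -/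
  coefB : List ℕ
  /-- allow-list: the outside parts `y ∖ U` of the solutions with `|y ∖ U| ≤ f` -/
  allow : List ℕ

/-- **The coset checker** `cosetOK nq Hq D P`: `y0 < 2^nq` solves `Hq y0 = σ` and vanishes on `T`; every row of `G`
is in `ker Hq`, below `2^nq`, and `G` is systematic on `T` with `T ∩ U = ∅`; every row of `BU` is in `ker Hq`, below
`2^nq` and inside `U`; every generator `D[i]` of the kernel equals `xorSel G coefG[i] ⊕ xorSel BU coefB[i]`; and the
ENUMERATION VERDICT: the tree's `scan`
with leaf `bzLeaf f allow` over the rows of `G` with `U`-bits cleared, budget `f`, started at selection word `2^|G|`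
(never zero) and codeword `clr U y0` — i.e. every `clr U (y0 ⊕ Σ_{j∈s} G_j)`, `|s| ≤ f`, has weight `> f` or is
allow-listed. (definition) -/
def cosetOK (nq : ℕ) (Hq D : List ℕ) (P : CosetProb) : Bool :=
  synEqOK nq Hq P.y0 P.sigma && decide (P.y0 < 2 ^ nq) && (P.y0 &&& maskOf P.T == 0) &&
    (P.G.all fun g => synZero nq Hq g && decide (g < 2 ^ nq)) && systematicOK nq P.G P.T &&
    (maskOf P.T &&& P.U == 0) &&
    (P.BU.all fun b => synZero nq Hq b && decide (b < 2 ^ nq) && (b &&& P.U == b)) &&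
    ((List.range D.length).all fun i =>
      (xorSel P.G (P.coefG.getD i 0) ^^^ xorSel P.BU (P.coefB.getD i 0)) == D.getD i 0) &&
    scan (bzLeaf P.f P.allow) (rowPos (P.G.map (clr P.U)) 0) P.f (2 ^ P.G.length) (clr P.U P.y0)

/-! ### Bit lemmas for `clr`, `selOf`, `xorSel` -/

/-- Bits of `clr`: `x AND NOT U`. -/
theorem testBit_clr (U x q : ℕ) : (clr U x).testBit q = (x.testBit q && !U.testBit q) := by
  rw [clr, Nat.testBit_xor, Nat.testBit_and]
  cases x.testBit q <;> cases U.testBit q <;> rfl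

/-- `clr` is additive. -/
theorem clr_xor (U a b : ℕ) : clr U (a ^^^ b) = clr U a ^^^ clr U b := by
  apply Nat.eq_of_testBit_eq; intro q
  rw [testBit_clr, Nat.testBit_xor, Nat.testBit_xor, testBit_clr, testBit_clr]
  cases a.testBit q <;> cases b.testBit q <;> cases U.testBit q <;> rfl

/-- `clr U 0 = 0`. -/
theorem clr_zero (U : ℕ) : clr U 0 = 0 := by
  apply Nat.eq_of_testBit_eq; intro q; rw [testBit_clr]; simp

/-- A word inside `U` is cleared entirely. -/
theorem clr_of_and_eq {U b : ℕ} (h : b &&& U = b) : clr U b = 0 := by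
  apply Nat.eq_of_testBit_eq; intro q
  have := congrArg (fun x => Nat.testBit x q) h
  simp only [Nat.testBit_and] at this
  rw [testBit_clr, Nat.zero_testBit]
  revert this
  cases b.testBit q <;> cases U.testBit q <;> simp

/-- `clr` commutes with row selections. -/
theorem clr_xorSel (U : ℕ) : ∀ (L : List ℕ) (m : ℕ), clr U (xorSel L m) = xorSel (L.map (clr U)) m
  | [], _ => by simp [xorSel, clr_zero]
  | r :: rs, m => by
    rw [List.map_cons, xorSel, xorSel, clr_xor, clr_xorSel U rs (m / 2)]
    congr 1
    split <;> simp [clr_zero]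

/-- A selection of words inside `U` is cleared entirely. -/
theorem clr_xorSel_of_forall {U : ℕ} {L : List ℕ} (h : ∀ b ∈ L, b &&& U = b) (m : ℕ) : clr U (xorSel L m) = 0 := by
  induction L generalizing m with
  | nil => simp [xorSel, clr_zero]
  | cons r rs ih =>
    rw [xorSel, clr_xor, ih (fun b hb => h b (List.mem_cons_of_mem _ hb)) (m / 2), Nat.xor_zero]
    split
    · exact clr_of_and_eq (h r List.mem_cons_self)
    · exact clr_zero U

/-- `clr` never sets a bit: `clr U x < 2^n` whenever `x < 2^n`. -/
theorem clr_lt {U x n : ℕ} (hx : x < 2 ^ n) : clr U x < 2 ^ n := by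
  refine Nat.lt_pow_two_of_testBit _ fun i hi => ?_
  rw [testBit_clr, Nat.testBit_lt_two_pow (lt_of_lt_of_le hx (Nat.pow_le_pow_right (by norm_num) hi))]
  rfl

/-- A bit that is unset in every row is unset in every selection. -/
theorem testBit_xorSel_of_forall {q : ℕ} : ∀ (L : List ℕ), (∀ b ∈ L, b.testBit q = false) → ∀ m : ℕ,
    (xorSel L m).testBit q = false
  | [], _, _ => by simp [xorSel]
  | r :: rs, h, m => by
    rw [xorSel, Nat.testBit_xor, testBit_xorSel_of_forall rs (fun b hb => h b (List.mem_cons_of_mem _ hb)) (m / 2)]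
    split
    · rw [h r List.mem_cons_self]; rfl
    · rw [Nat.zero_testBit]; rfl

/-- `xorSel` only reads the bits of the selection word below the number of rows. -/
theorem xorSel_congr : ∀ (L : List ℕ) {w w' : ℕ}, (∀ i, i < L.length → w.testBit i = w'.testBit i) →
    xorSel L w = xorSel L w'
  | [], _, _, _ => by simp [xorSel]
  | r :: rs, w, w', h => by
    have h0 := h 0 (by simp)
    rw [Nat.testBit_zero, Nat.testBit_zero] at h0
    have h0' : (w % 2 = 1) ↔ (w' % 2 = 1) := decide_eq_decide.1 h0
    rw [xorSel, xorSel, xorSel_congr rs (w := w / 2) (w' := w' / 2) fun i hi => by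
      rw [← Nat.testBit_succ, ← Nat.testBit_succ]; exact h (i + 1) (by simpa using hi)]
    congr 1
    by_cases hw : w % 2 = 1
    · rw [if_pos hw, if_pos (h0'.1 hw)]
    · rw [if_neg hw, if_neg (fun h' => hw (h0'.2 h'))]

/-- Bits of `selOf`. -/
theorem testBit_selOf {T : List ℕ} {j : ℕ} (hj : j < T.length) (y : ℕ) :
    (selOf T y).testBit j = y.testBit (T.getD j 0) := by
  rw [selOf, testBit_mkBits_of_lt _ hj]

/-- The vector of a `mkBits` word. -/
theorem ofBits_mkBits (k : ℕ) (f : ℕ → Bool) :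
    ofBits k (mkBits k f) = fun j : Fin k => if f j.1 then (1 : ZMod 2) else 0 := by
  funext j
  rw [ofBits, testBit_mkBits_of_lt _ j.2]

/-- `ofBits n` is injective on numerals below `2^n` (restated next to the checker's `ofBits`). -/
theorem ofBits_inj' {n a b : ℕ} (ha : a < 2 ^ n) (hb : b < 2 ^ n) (h : ofBits n a = ofBits n b) : a = b := by
  refine Nat.eq_of_testBit_eq fun i => ?_
  by_cases hi : i < n
  · have := congrFun h ⟨i, hi⟩
    simp only [ofBits] at this
    revert this
    cases a.testBit i <;> cases b.testBit i <;> simp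
  · rw [Nat.testBit_lt_two_pow (lt_of_lt_of_le ha (Nat.pow_le_pow_right (by norm_num) (Nat.not_lt.1 hi))),
      Nat.testBit_lt_two_pow (lt_of_lt_of_le hb (Nat.pow_le_pow_right (by norm_num) (Nat.not_lt.1 hi)))]

/-- Every element of the row space of a row list is the vector of some selection of the rows. -/
theorem exists_xorSel_of_mem_rowSpace {n : ℕ} {G : List ℕ} {g : Fin n → ZMod 2}
    (hg : g ∈ rowSpace (rowMatrix n G)) : ∃ w : ℕ, ofBits n (xorSel G w) = g := by
  rw [rowSpace_rowMatrix_eq_span, Submodule.mem_span_range_iff_exists_fun] at hg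
  obtain ⟨a, rfl⟩ := hg
  refine ⟨mkBits G.length fun j => if h : j < G.length then decide (a ⟨j, h⟩ ≠ 0) else false, ?_⟩
  rw [ofBits_xorSel_eq_vecMul, ofBits_mkBits, sum_smul_rowMatrix_eq_vecMul]
  congr 1
  funext j
  have hx : ∀ x : ZMod 2, (if (decide (x ≠ 0)) = true then (1 : ZMod 2) else 0) = x := by decide
  rw [dif_pos j.2]
  exact hx (a j)

/-! ### Soundness of the coset checker -/

/-- **L-coset, soundness of the coset checker** (README §4): if `cosetOK nq Hq D P` passes and the list `D` spans
`ker Hq` (for a CSS side: `D = H^Z pivot rows ++ logicals`, by L1 `exists_coeffs_of_ker`), then every solution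
`y < 2^nq` of `Hq y = σ` whose outside part `y ∖ U` has weight `≤ f` (i) has `clr U y` ALLOW-LISTED and (ii) is
`y0 ⊕ xorSel G (selOf T y) ⊕ b` with `b = xorSel BU m` a combination of the inside-`U` kernel rows — the selection
being read off `y` (equivalently off the allow-list entry) on `T`. Proof: `y ⊕ y0 ∈ ker Hq = span D ≤ span G ⊔ span BU`;
evaluate on `T` (systematic, `y0|_T = 0`, `BU|_T = 0`); the scan reached that selection (`|sel| ≤ |y ∖ U| ≤ f`). -/
theorem coset_sound {nq : ℕ} {Hq D : List ℕ} {P : CosetProb} (hok : cosetOK nq Hq D P = true)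
    (hD : ∀ z : Fin nq → ZMod 2, rowMatrix nq Hq *ᵥ z = 0 →
      z ∈ Submodule.span (ZMod 2) (Set.range fun i : Fin D.length => ofBits nq D[i]))
    {y : ℕ} (hy : y < 2 ^ nq) (hsyn : synEqOK nq Hq y P.sigma = true) (hwt : popc nq (clr P.U y) ≤ P.f) :
    clr P.U y ∈ P.allow ∧ ∃ m : ℕ, y = P.y0 ^^^ xorSel P.G (selOf P.T y) ^^^ xorSel P.BU m := by
  simp only [cosetOK, Bool.and_eq_true, List.all_eq_true, List.mem_range, beq_iff_eq, decide_eq_true_eq] at hok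
  obtain ⟨⟨⟨⟨⟨⟨⟨⟨hy0syn, hy0lt⟩, hy0T⟩, hG⟩, hsys⟩, hTU⟩, hBU⟩, hcoef⟩, hscan⟩ := hok
  -- (d) y ⊕ y0 is a kernel word, hence in span G ⊔ span BU
  have hz : rowMatrix nq Hq *ᵥ ofBits nq (y ^^^ P.y0) = 0 :=
    (synZero_iff _ _ _).1 (synZero_xor_of_synEqOK hsyn hy0syn)
  have hsup : ofBits nq (y ^^^ P.y0) ∈ rowSpace (rowMatrix nq P.G) ⊔ rowSpace (rowMatrix nq P.BU) := by
    refine (Submodule.span_le.2 ?_) (hD _ hz)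
    rintro _ ⟨i, rfl⟩
    have hi := hcoef i i.2
    have hDi : D[(i : ℕ)] = D.getD i 0 := by
      rw [List.getD_eq_getElem?_getD, List.getElem?_eq_getElem i.2, Option.getD_some]
    change ofBits nq D[(i : ℕ)] ∈ _
    rw [hDi, ← hi, ofBits_xor]
    exact Submodule.add_mem_sup (ofBits_xorSel_mem_rowSpace _ _ _) (ofBits_xorSel_mem_rowSpace _ _ _)
  obtain ⟨g, hg, b, hb, hgb⟩ := Submodule.mem_sup.1 hsup
  obtain ⟨wG, rfl⟩ := exists_xorSel_of_mem_rowSpace hg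
  obtain ⟨wB, rfl⟩ := exists_xorSel_of_mem_rowSpace hb
  -- numerals: y = y0 ⊕ xorSel G wG ⊕ xorSel BU wB
  have hGlt : xorSel P.G wG < 2 ^ nq := xorSel_lt nq P.G (fun g hg => (hG g hg).2) wG
  have hBlt : xorSel P.BU wB < 2 ^ nq := xorSel_lt nq P.BU (fun b hb => (hBU b hb).1.2) wB
  have hyeq : y = P.y0 ^^^ xorSel P.G wG ^^^ xorSel P.BU wB := by
    have h1 : ofBits nq (y ^^^ P.y0) = ofBits nq (xorSel P.G wG ^^^ xorSel P.BU wB) := by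
      rw [← hgb, ← ofBits_xor]
    have h2 := ofBits_inj' (Nat.xor_lt_two_pow hy hy0lt) (Nat.xor_lt_two_pow hGlt hBlt) h1
    apply Nat.eq_of_testBit_eq; intro q
    have := congrArg (fun x => Nat.testBit x q) h2
    simp only [Nat.testBit_xor] at this ⊢
    revert this
    cases y.testBit q <;> cases P.y0.testBit q <;> cases (xorSel P.G wG).testBit q <;>
      cases (xorSel P.BU wB).testBit q <;> simp
  -- (e) the selection is read off y on T
  have hTlen : P.G.length = P.T.length := by
    simp only [systematicOK, Bool.and_eq_true, beq_iff_eq] at hsys; exact hsys.1.1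
  have hsel : xorSel P.G wG = xorSel P.G (selOf P.T y) := by
    refine xorSel_congr P.G fun j hj => ?_
    have hjT : j < P.T.length := hTlen ▸ hj
    rw [testBit_selOf hjT, hyeq, Nat.testBit_xor, Nat.testBit_xor]
    -- y0 vanishes on T
    have hTmem : P.T.getD j 0 ∈ P.T := by
      rw [List.getD_eq_getElem?_getD, List.getElem?_eq_getElem hjT, Option.getD_some]; exact List.getElem_mem hjT
    have h0 : P.y0.testBit (P.T.getD j 0) = false := by
      have := congrArg (fun x => Nat.testBit x (P.T.getD j 0)) hy0T
      simp only [Nat.testBit_and, testBit_maskOf, Nat.zero_testBit, decide_eq_true hTmem, Bool.and_true] at this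
      exact this
    -- BU rows vanish on T
    have hUT : P.U.testBit (P.T.getD j 0) = false := by
      have := congrArg (fun x => Nat.testBit x (P.T.getD j 0)) hTU
      simp only [Nat.testBit_and, testBit_maskOf, Nat.zero_testBit, decide_eq_true hTmem, Bool.true_and] at this
      exact this
    have hB : (xorSel P.BU wB).testBit (P.T.getD j 0) = false := by
      refine testBit_xorSel_of_forall P.BU (fun b hb => ?_) wB
      have := congrArg (fun x => Nat.testBit x (P.T.getD j 0)) (hBU b hb).2
      simp only [Nat.testBit_and, hUT, Bool.and_false] at this
      exact this.symm
    -- G is systematic on T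
    have hGbit : (xorSel P.G wG).testBit (P.T.getD j 0) = wG.testBit j := by
      simp only [systematicOK, Bool.and_eq_true, List.all_eq_true, List.mem_range, beq_iff_eq,
        decide_eq_true_eq] at hsys
      have hq : P.T.getD j 0 < nq := hsys.1.2 _ hTmem
      have hv := congrFun (ofBits_xorSel_eq_vecMul nq P.G wG) ⟨P.T.getD j 0, hq⟩
      rw [← sum_smul_rowMatrix_eq_vecMul, Finset.sum_apply] at hv
      have hrow : ∀ i : Fin P.G.length, (ofBits P.G.length wG i • rowMatrix nq P.G i) ⟨P.T.getD j 0, hq⟩ =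
          if i = ⟨j, hj⟩ then ofBits P.G.length wG i else 0 := by
        intro i
        have hbit := hsys.2 i (hTlen ▸ i.2) j hjT
        rw [List.getD_eq_getElem?_getD, List.getElem?_eq_getElem i.2, Option.getD_some] at hbit
        rw [Pi.smul_apply, smul_eq_mul]
        change ofBits P.G.length wG i * ofBits nq (P.G[(i : ℕ)]) ⟨P.T.getD j 0, hq⟩ = _
        rw [ofBits, ofBits]
        simp only [hbit, Fin.ext_iff]
        by_cases hij : (i : ℕ) = j <;> simp [hij]
      rw [Finset.sum_congr rfl fun i _ => hrow i] at hv
      simp only [Finset.sum_ite_eq', Finset.mem_univ, if_true] at hv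
      simp only [ofBits] at hv
      revert hv
      cases (xorSel P.G wG).testBit (P.T.getD j 0) <;> cases wG.testBit j <;> simp
    rw [h0, hB, hGbit]
    simp
  refine ⟨?_, wB, by rw [← hsel]; exact hyeq⟩
  -- (f) the scan reached the selection `s = selOf T y` of the cleared rows
  rw [hsel] at hyeq
  set s := selOf P.T y with hs
  set Gc := P.G.map (clr P.U) with hGc
  have hGclen : Gc.length = P.G.length := List.length_map _
  have hGclt : ∀ g ∈ Gc, g < 2 ^ nq := by
    intro g hg; rw [hGc, List.mem_map] at hg
    obtain ⟨g', hg', rfl⟩ := hg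
    exact clr_lt (hG g' hg').2
  let a : Fin Gc.length → ZMod 2 := ofBits Gc.length s
  -- the length of the support list: |s| ≤ |y ∖ U| ≤ f
  have hTinj : ∀ j j', j < P.T.length → j' < P.T.length → P.T.getD j 0 = P.T.getD j' 0 → j = j' := by
    simp only [systematicOK, Bool.and_eq_true, List.all_eq_true, List.mem_range, beq_iff_eq,
      decide_eq_true_eq] at hsys
    intro j j' hj hj' hjj
    have h1 := hsys.2 j hj j hj
    have h2 := hsys.2 j hj j' hj'
    rw [hjj] at h1
    rw [h1] at h2
    simpa using h2
  have hslen : (rowSupp Gc a).length ≤ P.f := by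
    rw [length_rowSupp, hammingNorm_ofBits]
    refine le_trans ?_ hwt
    rw [← card_bitSet, ← card_bitSet]
    simp only [systematicOK, Bool.and_eq_true, List.all_eq_true, List.mem_range, beq_iff_eq,
      decide_eq_true_eq] at hsys
    have hTlt : ∀ j, j < P.T.length → P.T.getD j 0 < nq := fun j hj => hsys.1.2 _ (by
      rw [List.getD_eq_getElem?_getD, List.getElem?_eq_getElem hj, Option.getD_some]; exact List.getElem_mem hj)
    refine Finset.card_le_card_of_injOn (fun j => ⟨P.T.getD j 0 % nq, Nat.mod_lt _ (by
      have h1 := j.2; have h2 := hTlt j (by omega); omega)⟩) ?_ ?_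
    · intro j hj
      have hjT : (j : ℕ) < P.T.length := by have := j.2; omega
      rw [Finset.mem_coe, mem_bitSet, hs, testBit_selOf hjT] at hj
      simp only [Finset.mem_coe, mem_bitSet, testBit_clr]
      rw [Nat.mod_eq_of_lt (hTlt j hjT), hj]
      have hTmem : P.T.getD j 0 ∈ P.T := by
        rw [List.getD_eq_getElem?_getD, List.getElem?_eq_getElem hjT, Option.getD_some]; exact List.getElem_mem hjT
      have := congrArg (fun x => Nat.testBit x (P.T.getD j 0)) hTU
      simp only [Nat.testBit_and, testBit_maskOf, Nat.zero_testBit, decide_eq_true hTmem, Bool.true_and] at this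
      rw [this]; rfl
    · intro j _ j' _ hjj
      have hjT : (j : ℕ) < P.T.length := by have := j.2; omega
      have hjT' : (j' : ℕ) < P.T.length := by have := j'.2; omega
      simp only [Fin.mk.injEq, Nat.mod_eq_of_lt (hTlt j hjT), Nat.mod_eq_of_lt (hTlt j' hjT')] at hjj
      exact Fin.ext (hTinj j j' hjT hjT' hjj)
  have hleaf := reaches_of_scan hscan (rowSupp Gc a) (rowSupp_sublist Gc a) hslen
  -- the selection word is nonzero (bit |G| survives)
  have hfst : xorFst (rowSupp Gc a) < 2 ^ P.G.length := by
    rw [xorFst, rowSupp, List.map_map]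
    refine xorList_lt _ _ fun x hx => ?_
    rw [List.mem_map] at hx
    obtain ⟨j, hj, rfl⟩ := hx
    exact Nat.pow_lt_pow_right (by norm_num) (hGclen ▸ lt_of_mem_suppIdx _ a hj)
  have hu : (2 ^ P.G.length ^^^ xorFst (rowSupp Gc a) == 0) = false := by
    rw [beq_eq_false_iff_ne]
    intro h0
    have := congrArg (fun x => Nat.testBit x P.G.length) h0
    simp only [Nat.testBit_xor, Nat.testBit_two_pow_self, Nat.testBit_lt_two_pow hfst, Nat.zero_testBit] at this
    exact Bool.noConfusion this
  -- the codeword is `clr U y`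
  have hsnd : xorSnd (rowSupp Gc a) = xorSel Gc s := by
    refine ofBits_inj' (n := nq) ?_ (xorSel_lt nq Gc hGclt s) ?_
    · rw [xorSnd, rowSupp, List.map_map]
      refine xorList_lt _ _ fun x hx => ?_
      rw [List.mem_map] at hx
      obtain ⟨j, hj, rfl⟩ := hx
      have hjl : j < Gc.length := lt_of_mem_suppIdx _ a hj
      simp only [Function.comp_apply, List.getD_eq_getElem?_getD, List.getElem?_eq_getElem hjl, Option.getD_some]
      exact hGclt _ (List.getElem_mem hjl)
    · rw [ofBits_xorSnd_rowSupp, ofBits_xorSel_eq_vecMul]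
  have hc : clr P.U P.y0 ^^^ xorSnd (rowSupp Gc a) = clr P.U y := by
    rw [hsnd, hGc, ← clr_xorSel, hyeq, clr_xor, clr_xor,
      clr_xorSel_of_forall (fun b hb => (hBU b hb).2) wB, Nat.xor_zero]
  have hw : wtGt P.f (clr P.U y) = false := by
    cases h : wtGt P.f (clr P.U y)
    · rfl
    · exact absurd (lt_popc_of_wtGt nq _ _ (clr_lt hy) h) (not_lt.2 hwt)
  rw [bzLeaf, hu, hc, hw, Bool.false_or, Bool.false_or] at hleaf
  exact List.mem_of_elem_eq_true hleaf

/-- A functional that is even on every row of a list is even on every selection of it. -/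
theorem popc_and_xorSel_even {n Lam : ℕ} {L : List ℕ} (h : ∀ b ∈ L, popc n (Lam &&& b) % 2 = 0) (m : ℕ) :
    popc n (Lam &&& xorSel L m) % 2 = 0 := by
  induction L generalizing m with
  | nil => simp [xorSel, popc_zero]
  | cons r rs ih =>
    rw [xorSel, Nat.and_xor_distrib_left, popc_xor_mod_two, Nat.add_mod,
      ih (fun b hb => h b (List.mem_cons_of_mem _ hb)) (m / 2)]
    split
    · rw [h r List.mem_cons_self]
    · rw [Nat.and_zero, popc_zero]

/-- **Reading a linear functional off the allow-list** (the shape both levels use): if `Λ` (a word) has even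
overlap with every `BU` row, then for a solution `y` as in `coset_sound` the parity `|Λ ∩ y|` is
`|Λ ∩ y0| + Σ_{j ∈ selOf T y} |Λ ∩ G_j|` (mod 2) — a function of the allow-listed outside part alone. -/
theorem functional_of_coset {nq : ℕ} {P : CosetProb} {Lam y m : ℕ}
    (hBU : ∀ b ∈ P.BU, popc nq (Lam &&& b) % 2 = 0)
    (hy : y = P.y0 ^^^ xorSel P.G (selOf P.T y) ^^^ xorSel P.BU m) :
    popc nq (Lam &&& y) % 2 = popc nq (Lam &&& (P.y0 ^^^ xorSel P.G (selOf P.T y))) % 2 := by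
  have hB := popc_and_xorSel_even hBU m
  conv_lhs => rw [hy]
  rw [Nat.and_xor_distrib_left, popc_xor_mod_two, Nat.add_mod, hB, Nat.add_zero, Nat.mod_mod]

/-! ## Control: a two-row toy problem -/

/-- Toy control: `nq = 4`, `Hq = [0b1111]` (one even-parity check), kernel generators `D = G = [0b0011, 0b0101,
0b1001]` (systematic on `T = [1,2,3]`), problem `U = {0}`, `f = 1`, `σ = 1` (the odd words), `y0 = 0b0001`, no
inside-`U` kernel rows; the outside parts of the odd words `y` with `|y ∖ {0}| ≤ 1` are `0, 0b0010, 0b0100, 0b1000`. -/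
def toyCoset : CosetProb :=
  { U := 1, f := 1, sigma := 1, y0 := 1, T := [1, 2, 3], G := [3, 5, 9], BU := [], coefG := [1, 2, 4],
    coefB := [0, 0, 0], allow := [0, 2, 4, 8] }

/-- The toy problem passes the checker (`D = G`). -/
theorem toyCoset_ok : cosetOK 4 [15] [3, 5, 9] toyCoset = true := by decide

end Summit.Ventures.QEC.Census
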